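import Summits.QuantumFields.YangMills.Theorems.BalabanUVNodesPortU8DecayConversion

/-!
# PORT PT-B (U8), file 8 — ROW (R1ᴰ) AT ONE VOLUME∕DOMAIN∕LABEL: the DISTANCE conversion `dist(y, X) ≤ tdist(coarsen b.src, y₀) + 4Mc` for bonds of `X`, and the
# GAUGE PACKAGING — `gauge (recordDom44J … X α₂) (cutTo … (recordGkJ … a y)) ≤ C₉·e^{−δ₉·dist(y,X)}` FROM 27931⁷'s three entrywise decay clauses (TokP9dec) and a displayed
# `𝐉`-block bound, with the EXPLICIT `C₉ = 2(2C + C_J + 1)e^{4δ₉Mc}∕α₂`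

Cell `ym-nodeO-ideate` ∕ `ym-balaban-port`, porter `ymgap-nodeO-port-PTB-1` (gen 0), item **stmt-QuantumFields-27931** `BalabanUVNodes.PortPieceLocalityU8` (string ⁷
sha16 `2b1f3e71e82c2820`); PORT-PLAN-v1 row U8-C1; `--kind proof --supports stmt-QuantumFields-27931` (helper).  [I] = [Balaban1987RG1], [15] = [Balaban1985Variational].
CONSUMED BY NAME: file 7 (the three clause conversions), file 2 (`mem_domSites_iff`, `recordN_eq_domCount_mul` via DEF-1's Lemmas), DEF-1's names (`cubeIdxOf ∕ coarsenTo ∕ idxDist ∕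
recordDistC ∕ recordSiteGeom ∕ recordDom44J ∕ chartMatU(Jc)LM`), `recordSiteGeom_distD_le`, Mathlib's `gauge_le_of_mem`, `Set.mem_smul_set_iff_inv_smul_mem₀`.
WHAT THIS FILE PROVES (theorems only; no `def ∕ instance ∕ notation ∕ sorry`; standard axioms; tiled range).
§B `val_blockOf'`, `val_coarsenTo` (`coarsenTo n` divides coordinates by `L^n`), `cubeIdxOf_coarsenTo_mem` (the `Mc`-cube of the coarse source of a site of `X` is a cube of `X`),
   `mul_val_cube_sub_le` ∕ `mul_min_val_cube_le` (torus floor-division bookkeeping `M·(⌊a∕M⌋ − ⌊b∕M⌋).val ≤ (a − b).val + M`), `mul_idxDist_cubeIdxOf_le`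
   (`Mc·idxDist(cube y, cube x) ≤ tdist x y + 4Mc`), ★ `distD_le_tdist_add` (`dist(y, X) ≤ tdist(coarsen b.src, y₀) + 4Mc` for `b ∈ X`), `exp_neg_tdist_le`.
§C `chartMatU_real_smul ∕ chartMatJc_real_smul`, `gauge_recordDom44J_le` (`t⁻¹•w ∈ D ⇒ gauge D w ≤ t`), ★★★ `rowR1D_at_of_entryDecay` — THE ROW: from the three entrywise decay
   clauses with constants `(C, δ₉)` at every bond and a `𝐉`-block bound `C_J·e_b` on the bonds of `X`, `gauge ≤ 2(2C + C_J + 1)e^{4δ₉Mc}∕α₂ · e^{−δ₉·dist(y,X)}`.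
RESIDUE RECORDED: against ⁷, (R1ᴰ) now follows from TokP9reg + TokP9dec + ONE displayed `𝐉`-block bound (the linearised current; nodeO STATUS 00:3xZ request TokP9cur); (R4ᴰ)
(two-volume) remains content with no token.
HONEST FRAMING.  Distance∕norm∕gauge bookkeeping; NOTHING of Bałaban's analysis asserted, ported or discharged; 27931⁷ OPEN; K0⁷ NOT closed; NODE O 0∕1; COUNT 8∕28 · K 1∕4 UNMOVED;
finite `𝕋⁴_{L^K}` at fixed ε — NOT continuum ∕ OS ∕ Clay; **the Yang–Mills mass gap (Clay) is NOT proved by any of this.**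
-/

noncomputable section

open scoped BigOperators Matrix.Norms.L2Operator

namespace Summit.QuantumFields.YangMills.Theorems.PortU8

open Literature.MathematicalPhysics.QuantumFieldTheory.Balaban1983to89
open Literature.MathematicalPhysics.QuantumFieldTheory.Balaban1983to89.Node00
open Literature.MathematicalPhysics.QuantumFieldTheory.Balaban1983to89.T4Continuum (T4Family)
open Summit.QuantumFields.YangMills.Theorems.K0RecordFormatNames

variable (F : T4Family)

/-! ## Stage B — distance conversion -/

/-- The block map divides the coordinate values by `L` (standing range `j + 1 ≤ m + K`). [cite: Balaban1987RG1, (0.3) p.252 (bookkeeping)] -/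
theorem val_blockOf' {P : Params} {j : ℕ} (hj : j + 1 ≤ P.m + P.K) (x : Site P j) (μ : Fin P.d) : ((blockOf x) μ).val = (x μ).val / P.L := by
  have hlt : (x μ).val / P.L < P.sitesPerDir (j + 1) := by
    have hv : (x μ).val < P.sitesPerDir j := ZMod.val_lt _
    have hN : P.sitesPerDir j = P.L * P.sitesPerDir (j + 1) := by
      unfold Params.sitesPerDir
      rw [show P.m + P.K - j = (P.m + P.K - (j + 1)) + 1 by omega, pow_succ]
      ring
    exact Nat.div_lt_of_lt_mul (lt_of_lt_of_eq hv hN)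
  show (((x μ).val / P.L : ℕ) : ZMod (P.sitesPerDir (j + 1))).val = _
  rw [ZMod.val_natCast, Nat.mod_eq_of_lt hlt]

/-- `coarsenTo n` divides the coordinate values by `L^n` (standing range `n ≤ m + K`). [cite: Balaban1987RG1, (0.3) p.252 (bookkeeping)] -/
theorem val_coarsenTo {P : Params} (n : ℕ) (hn : n ≤ P.m + P.K) (x : Site P 0) (μ : Fin P.d) : (coarsenTo n x μ).val = (x μ).val / P.L ^ n := by
  induction n with
  | zero => simp [coarsenTo]
  | succ n ih =>
    show ((blockOf (coarsenTo n x)) μ).val = _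
    rw [val_blockOf' (by omega) (coarsenTo n x) μ, ih (by omega), Nat.div_div_eq_div_mul, pow_succ]

variable {F} in
/-- For a site of `X`, the `Mc`-cube of its coarse image IS a cube of `X` (tiled range). [cite: Balaban1987RG1, p.257 (bookkeeping)] -/
theorem cubeIdxOf_coarsenTo_mem {Mc k K : ℕ} (hMc : McGuard F Mc) (hK : recordK₀ F Mc k ≤ K) (X : (recordDomSys F Mc k K).Dom) {x : Site (F.P K) 0}
    (hx : x ∈ Sect2.domSites (F.P K) Mc (k + 1) X) : cubeIdxOf F Mc k K (coarsenTo (k + 1) x) ∈ (X.1 : Finset _) := by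
  rw [mem_domSites_iff hMc hK X x] at hx
  have hk : k + 1 ≤ (F.P K).m + (F.P K).K := by
    simp only [T4Family.P_m, T4Family.P_K]; unfold recordK₀ at hK; omega
  have heq : cubeIdxOf F Mc k K (coarsenTo (k + 1) x) =
      fun i => ((((x i).val / B14.Eq213MaximalDomains.side (F.P K).L Mc (k + 1) : ℕ)) : ZMod (Sect2.domCount (F.P K) Mc (k + 1))) := by
    funext i
    simp only [cubeIdxOf, val_coarsenTo (k + 1) hk x i, Nat.div_div_eq_div_mul]
    rfl
  rw [heq]
  exact hx

/-- **Integer bookkeeping on the torus**: for `a b : ZMod N`, `N = q·M`, and their `M`-cube indices `⌊a∕M⌋, ⌊b∕M⌋` read in `ZMod q`: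
`M · (⌊a∕M⌋ − ⌊b∕M⌋).val ≤ (a − b).val + M`. [folklore] -/
theorem mul_val_cube_sub_le {N q M : ℕ} [NeZero N] [NeZero q] (hN : N = q * M) (hM : 0 < M) (a b : ZMod N) :
    M * (((a.val / M : ℕ) : ZMod q) - ((b.val / M : ℕ) : ZMod q)).val ≤ (a - b).val + M := by
  subst hN
  set t := (a - b).val with ht
  have hab : a = b + (a - b) := by abel
  have hval : a.val = (b.val + t) % (q * M) := by
    conv_lhs => rw [hab]
    rw [ZMod.val_add]
  have hA : ((a.val / M : ℕ) : ZMod q) = (((b.val + t) / M : ℕ) : ZMod q) := by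
    rw [hval, Nat.mod_mul_left_div_self, ZMod.natCast_mod]
  rw [hA]
  set X := (b.val + t) / M with hX
  set Y := b.val / M with hY
  have hXY : Y ≤ X := Nat.div_le_div_right (Nat.le_add_right _ _)
  have hcast : (((X : ℕ) : ZMod q) - ((Y : ℕ) : ZMod q)) = ((X - Y : ℕ) : ZMod q) := by
    rw [Nat.cast_sub hXY]
  rw [hcast, ZMod.val_natCast]
  have h1 : M * X ≤ b.val + t := Nat.mul_div_le _ _
  have h2 : b.val < M * (Y + 1) := Nat.lt_mul_div_succ _ hM
  have hD : M * (X - Y) ≤ t + M := by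
    have : (M : ℤ) * ((X - Y : ℕ) : ℤ) ≤ t + M := by
      push_cast [Nat.cast_sub hXY]
      have h1' : (M : ℤ) * X ≤ b.val + t := by exact_mod_cast h1
      have h2' : (b.val : ℤ) < M * (Y + 1) := by exact_mod_cast h2
      nlinarith
    exact_mod_cast this
  calc M * ((X - Y) % q) ≤ M * (X - Y) := Nat.mul_le_mul_left _ (Nat.mod_le _ _)
    _ ≤ t + M := hD

/-- Hence for the torus DISTANCES (minimum of the two orientations): `M · min((A−B).val, (B−A).val) ≤ min((a−b).val, (b−a).val) + M`. [folklore] -/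
theorem mul_min_val_cube_le {N q M : ℕ} [NeZero N] [NeZero q] (hN : N = q * M) (hM : 0 < M) (a b : ZMod N) :
    M * min (((a.val / M : ℕ) : ZMod q) - ((b.val / M : ℕ) : ZMod q)).val ((((b.val / M : ℕ) : ZMod q) - ((a.val / M : ℕ) : ZMod q))).val ≤
      min (a - b).val (b - a).val + M := by
  have h1 := mul_val_cube_sub_le hN hM a b
  have h2 := mul_val_cube_sub_le hN hM b a
  rw [← min_add_add_right]
  refine le_min ?_ ?_
  · exact (Nat.mul_le_mul_left _ (min_le_left _ _)).trans h1
  · exact (Nat.mul_le_mul_left _ (min_le_right _ _)).trans h2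

variable {F} in
/-- **`Mc · idxDist(cube y, cube x) ≤ tdist x y + 4·Mc`** for unit-lattice sites of `T^{(k+1)}` (tiled range: `N = q·Mc`). [cite: Balaban1987RG1, p.257 (bookkeeping)] -/
theorem mul_idxDist_cubeIdxOf_le {Mc k K : ℕ} (hMc : McGuard F Mc) (hK : recordK₀ F Mc k ≤ K) (hMc0 : 0 < Mc) (x y : Site (F.P K) (k + 1)) :
    Mc * idxDist (cubeIdxOf F Mc k K y) (cubeIdxOf F Mc k K x) ≤ Site.tdist x y + 4 * Mc := by
  have hN : (F.P K).sitesPerDir (k + 1) = Sect2.domCount (F.P K) Mc (k + 1) * Mc := recordN_eq_domCount_mul hMc hK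
  unfold idxDist Site.tdist
  rw [Finset.mul_sum]
  have hd : (Finset.univ : Finset (Fin (F.P K).d)).card = 4 := by rw [Finset.card_univ, Fintype.card_fin]; rfl
  calc ∑ i, Mc * min (cubeIdxOf F Mc k K y i - cubeIdxOf F Mc k K x i).val (cubeIdxOf F Mc k K x i - cubeIdxOf F Mc k K y i).val
      ≤ ∑ i, (min (y i - x i).val (x i - y i).val + Mc) := Finset.sum_le_sum fun i _ => mul_min_val_cube_le hN hMc0 (y i) (x i)
    _ = ∑ i, min (x i - y i).val (y i - x i).val + 4 * Mc := by
        rw [Finset.sum_add_distrib, Finset.sum_const, hd, smul_eq_mul]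
        congr 1
        exact Finset.sum_congr rfl fun i _ => min_comm _ _

variable {F} in
/-- ★ **DISTANCE CONVERSION**: for a bond `b` of `X` and a label `y = (μ, y₀)`, `dist(y, X) ≤ tdist(coarsen b.src, y₀) + 4·Mc` (in unit-lattice site units; tiled range).
[cite: Balaban1987RG1, p.257, (4.5) p.282 (bookkeeping)] -/
theorem distD_le_tdist_add {Mc k K : ℕ} (hMc : McGuard F Mc) (hK : recordK₀ F Mc k ≤ K) (X : (recordDomSys F Mc k K).Dom) {b : PBond (F.P K) 0}
    (hb : b ∈ domBonds F Mc k K X) (y : RespLabel F k K) :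
    (recordSiteGeom F Mc k K).distD y X ≤ (Site.tdist (coarsenTo (k + 1) b.src) y.2 : ℝ) + 4 * Mc := by
  obtain ⟨c, rfl⟩ := hMc
  have hMc0 : 0 < F.L ^ c := pow_pos (by have := F.hL.2; omega) _
  have hcube := cubeIdxOf_coarsenTo_mem ⟨c, rfl⟩ hK X hb.1
  refine (recordSiteGeom_distD_le F (F.L ^ c) k K y X hcube).trans ?_
  unfold recordDistC
  have h := mul_idxDist_cubeIdxOf_le ⟨c, rfl⟩ hK hMc0 (coarsenTo (k + 1) b.src) y.2
  exact_mod_cast h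

/-- Exponential form of the distance conversion: `e^{−δ·tdist} ≤ e^{4δMc}·e^{−δ·dist(y,X)}` for `δ ≥ 0`. [folklore] -/
theorem exp_neg_tdist_le {δ td dist Mc : ℝ} (hδ : 0 ≤ δ) (h : dist ≤ td + 4 * Mc) :
    Real.exp (-(δ * td)) ≤ Real.exp (4 * δ * Mc) * Real.exp (-δ * dist) := by
  rw [← Real.exp_add]
  exact Real.exp_le_exp.2 (by nlinarith)


/-! ## Stage C — the gauge packaging: row (R1ᴰ) at one (volume, domain, label) from the three entrywise clauses and a 𝐉-block bound -/

/-- Real scalars act on the two-block chart coordinates through `ℂ`: `chartMatU (r • w) b = (r : ℂ) • chartMatU w b`. [cite: Balaban1987RG1, (1.9) p.261 (bookkeeping)] -/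
theorem chartMatU_real_smul {K : ℕ} (r : ℝ) (w : Fin (recordChartDimJ F K) → ℂ) (b : PBond (F.P K) 0) :
    chartMatU F K (r • w) b = (r : ℂ) • chartMatU F K w b := by
  have h : r • w = (r : ℂ) • w := by funext i; simp [Complex.real_smul]
  rw [h]
  exact (chartMatULM F K b).map_smul (r : ℂ) w

/-- Same for the `𝐉`-block. [cite: Balaban1987RG1, (1.9) p.261 (bookkeeping)] -/
theorem chartMatJc_real_smul {K : ℕ} (r : ℝ) (w : Fin (recordChartDimJ F K) → ℂ) (b : PBond (F.P K) 0) :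
    chartMatJc F K (r • w) b = (r : ℂ) • chartMatJc F K w b := by
  have h : r • w = (r : ℂ) • w := by funext i; simp [Complex.real_smul]
  rw [h]
  exact (chartMatJcLM F K b).map_smul (r : ℂ) w

/-- **GAUGE PACKAGING**: if `t > 0` and `t⁻¹ • w` lies in print's (4.4) domain `recordDom44J … X α₂`, then `gauge (recordDom44J … X α₂) w ≤ t`. [cite: Balaban1987RG1, (4.4) p.281 (bookkeeping)] -/
theorem gauge_recordDom44J_le {Mc k K : ℕ} (X : (recordDomSys F Mc k K).Dom) (α₂ : ℝ) {t : ℝ} (ht : 0 < t) (w : Fin (recordChartDimJ F K) → ℂ)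
    (hw : t⁻¹ • w ∈ recordDom44J F Mc k K X α₂) : gauge (recordDom44J F Mc k K X α₂) w ≤ t :=
  gauge_le_of_mem ht.le ((Set.mem_smul_set_iff_inv_smul_mem₀ ht.ne' _ _).2 hw)

variable {F} in
/-- ★★★ **ROW (R1ᴰ) AT ONE VOLUME∕DOMAIN∕LABEL FROM ENTRYWISE DECAY + A 𝐉-BLOCK BOUND**: on the tiled range, if the entrywise derivative `D` of the background field in the
direction `δ_{y,a}` obeys the three scaled clauses of 27931⁷'s token TokP9dec with constants `C, δ₉` (value `Cη·e_b`, first differences `Cη²·e_b`, Laplacian `Cη³·e_b`,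
`e_b = e^{−δ₉·tdist(coarsen b.src, y₀)}`) at every bond, and the `𝐉`-block chart matrices of the cut response obey `‖·‖ ≤ C_J·e_b` on the bonds of `X` (the clause TokP9dec does NOT
carry — displayed), then `gauge (recordDom44J … X α₂) (cutTo (recordCXJ … X) (recordGkJ … a y)) ≤ C₉·e^{−δ₉·dist(y, X)}` with the EXPLICIT
`C₉ = 2(2C + C_J + 1)e^{4δ₉Mc}∕α₂`, uniform in `k`, `K`, `X`, `y`. [cite: Balaban1987RG1, (4.4)–(4.5) pp.281–282; Balaban1985Variational, (190) p.308] -/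
theorem rowR1D_at_of_entryDecay {Mc k K : ℕ} (hMc : McGuard F Mc) (hK : recordK₀ F Mc k ≤ K) (θ : Stage13Params F 2) (hε : 0 < θ.εbg)
    (hd2 : letI := θ.instVβ₁; letI := θ.instVβ₂;
      ContDiffAt ℝ 2 (fun B : Fin (F.P K).d → Site (F.P K) (k + 1) → θ.Vβ =>
        fun (b : PBond (F.P K) 0) (i i' : Fin 2) => ((recordBgField F θ k K B b : SU 2) : MatA 2) i i') 0)
    (a : θ.ιβ) (y : RespLabel F k K) (X : (recordDomSys F Mc k K).Dom) {α₂ C CJ δ₉ : ℝ} (hα : 0 < α₂) (hC : 0 ≤ C) (hCJ : 0 ≤ CJ) (hδ : 0 ≤ δ₉)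
    (hdec : letI := θ.instVβ₁; letI := θ.instVβ₂; letI := θ.instιβ;
      ∀ b : PBond (F.P K) 0,
        letI D := fderiv ℝ (fun B : Fin (F.P K).d → Site (F.P K) (k + 1) → θ.Vβ =>
          fun (b : PBond (F.P K) 0) (i i' : Fin 2) => ((recordBgField F θ k K B b : SU 2) : MatA 2) i i') 0 (Pi.single y.1 (Pi.single y.2 (θ.bV a)));
        ‖D b‖ ≤ C * (F.P K).eta (k + 1) * Real.exp (-(δ₉ * (Site.tdist (coarsenTo (k + 1) b.src) y.2 : ℝ))) ∧
        (∀ ν : Fin (F.P K).d, ‖D ⟨b.src.shift ν, b.dir⟩ - D b‖ ≤ C * (F.P K).eta (k + 1) ^ 2 * Real.exp (-(δ₉ * (Site.tdist (coarsenTo (k + 1) b.src) y.2 : ℝ)))) ∧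
        ‖∑ ν : Fin (F.P K).d, (D ⟨b.src.shift ν, b.dir⟩ - (2 : ℂ) • D b + D ⟨b.src.unshift ν, b.dir⟩)‖ ≤
          C * (F.P K).eta (k + 1) ^ 3 * Real.exp (-(δ₉ * (Site.tdist (coarsenTo (k + 1) b.src) y.2 : ℝ))))
    (hJ : letI := θ.instVβ₁; letI := θ.instVβ₂; letI := θ.instιβ;
      ∀ b ∈ domBonds F Mc k K X, ‖chartMatJc F K (B12FormatPlus.cutTo (recordCXJ F Mc k K X) (recordGkJ F θ k K a y)) b‖ ≤
        CJ * Real.exp (-(δ₉ * (Site.tdist (coarsenTo (k + 1) b.src) y.2 : ℝ)))) :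
    letI := θ.instVβ₁; letI := θ.instVβ₂; letI := θ.instιβ;
    gauge (recordDom44J F Mc k K X α₂) (B12FormatPlus.cutTo (recordCXJ F Mc k K X) (recordGkJ F θ k K a y)) ≤
      2 * (2 * C + CJ + 1) * Real.exp (4 * δ₉ * Mc) / α₂ * Real.exp (-δ₉ * (recordSiteGeom F Mc k K).distD y X) := by
  letI := θ.instVβ₁; letI := θ.instVβ₂; letI := θ.instιβ
  have hk : k + 1 ≤ (F.P K).m + (F.P K).K := by
    simp only [T4Family.P_m, T4Family.P_K]; unfold recordK₀ at hK; omega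
  set η := (F.P K).eta (k + 1) with hη
  have hη0 : 0 < η := by
    rw [hη]; unfold Params.eta
    have hL : (0 : ℝ) < (F.P K).L := by exact_mod_cast (F.P K).L_pos
    positivity
  set Ed := Real.exp (-δ₉ * (recordSiteGeom F Mc k K).distD y X) with hEd
  set A := 2 * (2 * C + CJ + 1) * Real.exp (4 * δ₉ * Mc) / α₂ with hA
  have hS : 0 < 2 * C + CJ + 1 := by linarith
  have hA0 : 0 < A := by rw [hA]; positivity
  have ht : 0 < A * Ed := mul_pos hA0 (Real.exp_pos _)
  -- the distance conversion at the bonds of `X`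
  have hconv : ∀ b ∈ domBonds F Mc k K X,
      Real.exp (-(δ₉ * (Site.tdist (coarsenTo (k + 1) b.src) y.2 : ℝ))) ≤ Real.exp (4 * δ₉ * Mc) * Ed := fun b hb =>
    exp_neg_tdist_le hδ (distD_le_tdist_add hMc hK X hb y)
  set w := B12FormatPlus.cutTo (recordCXJ F Mc k K X) (recordGkJ F θ k K a y) with hw
  refine gauge_recordDom44J_le F X α₂ ht w ?_
  set r : ℝ := (A * Ed)⁻¹ with hr
  have hr0 : 0 ≤ r := inv_nonneg.2 ht.le
  -- the key ratio: `e^{4δ₉Mc}·Ed ∕ (A·Ed) = α₂ ∕ (2(2C+C_J+1))`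
  have hratio : r * (Real.exp (4 * δ₉ * Mc) * Ed) = α₂ / (2 * (2 * C + CJ + 1)) := by
    rw [hr, hA]
    have hE : Ed ≠ 0 := (Real.exp_pos _).ne'
    have hX : Real.exp (4 * δ₉ * Mc) ≠ 0 := (Real.exp_pos _).ne'
    field_simp
  have hnorm_smul : ∀ M : MatA 2, ‖(r : ℂ) • M‖ = r * ‖M‖ := fun M => by
    rw [norm_smul, Complex.norm_real, Real.norm_of_nonneg hr0]
  -- generic step: a bound `c·e_b` with `e_b ≤ e^{4δ₉Mc}·Ed` becomes `< radius` after scaling by `r` whenever `c·α₂∕(2(2C+CJ+1)) < radius`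
  have step : ∀ {q c rad : ℝ} {b : PBond (F.P K) 0}, b ∈ domBonds F Mc k K X → 0 ≤ c →
      q ≤ c * Real.exp (-(δ₉ * (Site.tdist (coarsenTo (k + 1) b.src) y.2 : ℝ))) → c * (α₂ / (2 * (2 * C + CJ + 1))) < rad →
      r * q < rad := by
    intro q c rad b hb hc hq hlt
    have h1 : r * q ≤ r * (c * (Real.exp (4 * δ₉ * Mc) * Ed)) :=
      mul_le_mul_of_nonneg_left (hq.trans (mul_le_mul_of_nonneg_left (hconv b hb) hc)) hr0
    have h2 : r * (c * (Real.exp (4 * δ₉ * Mc) * Ed)) = c * (α₂ / (2 * (2 * C + CJ + 1))) := by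
      rw [← hratio]; ring
    linarith
  have hq1 : C * (α₂ / (2 * (2 * C + CJ + 1))) * 2 < α₂ := by
    rw [show C * (α₂ / (2 * (2 * C + CJ + 1))) * 2 = α₂ * (C / (2 * C + CJ + 1)) by field_simp]
    have : C / (2 * C + CJ + 1) < 1 := by rw [div_lt_one hS]; linarith
    nlinarith
  have hqJ : CJ * (α₂ / (2 * (2 * C + CJ + 1))) < α₂ := by
    rw [show CJ * (α₂ / (2 * (2 * C + CJ + 1))) = α₂ * (CJ / (2 * (2 * C + CJ + 1))) by field_simp]
    have : CJ / (2 * (2 * C + CJ + 1)) < 1 := by rw [div_lt_one (by linarith)]; linarith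
    nlinarith
  refine ⟨fun b hb => ?_, fun b hb ν hν => ?_, fun b hb hall => ?_, fun b hb => ?_⟩
  · -- value clause
    rw [chartMatU_real_smul, hnorm_smul]
    have hb1 := norm_chartMatU_cutTo_recordGkJ_le F θ k K hk hε hd2 a y X b hb (hdec b).1
    exact step hb (by positivity : 0 ≤ 2 * (C * η)) (by nlinarith [hb1, Real.exp_pos (-(δ₉ * (Site.tdist (coarsenTo (k + 1) b.src) y.2 : ℝ)))])
      (show 2 * (C * η) * (α₂ / (2 * (2 * C + CJ + 1))) < α₂ * η by nlinarith [hq1, hη0])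
  · -- first-difference clause
    rw [chartMatU_real_smul, chartMatU_real_smul, ← smul_sub, hnorm_smul]
    have hb1 := norm_chartMatU_diff_cutTo_recordGkJ_le F θ k K hk hε hd2 a y X b ⟨b.src.shift ν, b.dir⟩ hb hν ((hdec b).2.1 ν)
    exact step hb (by positivity : 0 ≤ 2 * (C * η ^ 2)) (by nlinarith [hb1, Real.exp_pos (-(δ₉ * (Site.tdist (coarsenTo (k + 1) b.src) y.2 : ℝ)))])
      (show 2 * (C * η ^ 2) * (α₂ / (2 * (2 * C + CJ + 1))) < α₂ * η ^ 2 by nlinarith [hq1, pow_pos hη0 2])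
  · -- Laplacian clause
    have hre : ∑ ν : Fin (F.P K).d, (chartMatU F K (r • w) ⟨b.src.shift ν, b.dir⟩ - (2 : ℂ) • chartMatU F K (r • w) b +
        chartMatU F K (r • w) ⟨b.src.unshift ν, b.dir⟩) =
        (r : ℂ) • ∑ ν : Fin (F.P K).d, (chartMatU F K w ⟨b.src.shift ν, b.dir⟩ - (2 : ℂ) • chartMatU F K w b + chartMatU F K w ⟨b.src.unshift ν, b.dir⟩) := by
      rw [Finset.smul_sum]
      refine Finset.sum_congr rfl fun ν _ => ?_
      rw [chartMatU_real_smul, chartMatU_real_smul, chartMatU_real_smul, smul_add, smul_sub, smul_comm (r : ℂ) (2 : ℂ)]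
    rw [hre, hnorm_smul]
    have hb1 := norm_chartMatU_laplace_cutTo_recordGkJ_le F θ k K hk hε hd2 a y X b hb hall ((hdec b).2.2)
    exact step hb (by positivity : 0 ≤ 2 * (C * η ^ 3)) (by nlinarith [hb1, Real.exp_pos (-(δ₉ * (Site.tdist (coarsenTo (k + 1) b.src) y.2 : ℝ)))])
      (show 2 * (C * η ^ 3) * (α₂ / (2 * (2 * C + CJ + 1))) < α₂ * η ^ 3 by nlinarith [hq1, pow_pos hη0 3])
  · -- 𝐉-block clause (displayed hypothesis)
    rw [chartMatJc_real_smul, hnorm_smul]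
    exact step hb hCJ (hJ b hb) hqJ


end Summit.QuantumFields.YangMills.Theorems.PortU8

end
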